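import Literature.NumberTheory.EllipticCurves.KatoAdditiveTwistedValueNeronIntegrality
import Mathlib.RingTheory.RootsOfUnity.Lemmas
import Mathlib.RingTheory.RootsOfUnity.Complex
import Mathlib.RingTheory.RootsOfUnity.Minpoly
import HarnessLib

/-!
# F″ programme, the UNIT CHOICE for Kato's Thm. 6.6 (1) (`SL₂(ℤ)`-type factor), part 1: the cyclotomic unit
# `c − μ` at `p` and Kato's factor `(c² − cμ)(d² − dν)` (route `EdixhovenFibreFiveSeven`, crux K★
# `StarredOptimalManinUnitFiveSeven`, stmt-BirchSwinnertonDyer-22226, line `kato-lever`; `--supports` 22226, helper)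

Cell `pub/bsd-wall`, seat `bsd-line-edix-p4` g3 (WIDTH-5 attach). TOOL theorems only (no definition, no named
fact, no `sorry`); nothing is closed or booked; BSD is not proved by any of this. Part 2 (Dirichlet characters,
the CRT choice of `c`, the socket `[divide T·u·n_ξ]`) is the sibling file `…KatoUnitChoiceCRT.lean`.

WHY. The registered skeleton `Cruxes/StarredOptimalManinUnitFiveSeven/Lines/kato_lever.lean` (v2) has ONE stub,
F″ = `Literature.NumberTheory.EllipticCurves.kato_neron_isIntegral_twistedSymbolSum_of_additive_five_le`
(cite-only, XL). Its docstring derivation has four items; item 4 "(Units)" / "(a) UNIT CHOICE" reads: with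
`c ≡ d ≡ 1 (mod N)` and `p ∣ N`, Kato's factor `T = (c² − c^u χ(c))(d² − d^v χ̄(d))` (`(u, v) = (1, 1)` at
`k = 2`, `r = r′ = 1`; Astérisque 295, Thm. 6.6 (1) p. 163, (4.2.4) p. 143) satisfies
`T ≡ (1 − χ(c))(1 − χ̄(d)) (mod p)`; "for `p ∤ n`, `1 − ζ_n` divides `n'` for a prime `n' ≠ p` or is a unit, so
`T` is a `p`-unit". The programme that would discharge F″ (`Lines/kato-lever-F2-programme.md` §4; pieces P1
typer, P2 ✓ p596837/p597608, P3 tree, P4-core ✓ p598912 (manin-p1 g8), P6 ✓ p597552/p597901, value exit ✓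
p598918 (edix-p5 g2)) composes as `P1(χ̄) ∘ receptacle exit per w ∘ semi-local descent ∘ [divide T·u·n_ξ] ∘
value exit`; this file and its sibling ARE the step `[divide T·u·n_ξ]`, written P1-SHAPE-TOLERANT: every lemma
is about an arbitrary root of unity `μ ∈ ℂ` of order prime to `p` (so it serves `χ(c)`, `χ̄(c) = χ⁻¹(c)`,
`χ(c)⁻¹` alike), an arbitrary integer `c ≡ 1 (mod p)`, and an arbitrary rational factor `w` with numerator
prime to `p` (Kato's real-structure factor `u ∈ {1, 2, ½}` and the Manin-symbol coordinate `n_ξ ∈ {±½, ±1}` of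
Thm. 13.6), in the currency "`∃ s : ℕ, p ∤ s, IsIntegral ℤ (s · x)`" (= "`x` is `p`-integral") of F″'s
displayed conclusion, of P4-core's output (`SemiLocalDescent.exists_not_dvd_isIntegral_charSum_…`) and of the
value exit's input (`StarredOptimalManinUnitFiveSevenValueExit.katoNeron_{even,odd}_of_depletedValue`, `hint`).

WHAT IS PROVED (all `p` prime).
* §1 the currency: `exists_nat_of_isIntegral_int_mul` (an integer multiplier prime to `p` may be replaced by a
  natural one), `exists_isIntegral_mul` (products), `exists_isIntegral_of_mul_left` (DIVISION: `T·x` `p`-integral,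
  `T⁻¹` `p`-integral, `T ≠ 0` ⟹ `x` `p`-integral), `exists_isIntegral_mul_inv_natCast`,
  `exists_isIntegral_mul_inv_ratCast` (`w ∈ ℚ` with `p ∤ num w` ⟹ `w⁻¹` `p`-integral).
* §2 the cyclotomic unit at `p`: `geom_sum_eq_prod_sub_pow` (in any domain, `ζ` a primitive `n`-th root:
  `Σ_{i<n} cⁱ = ∏_{0<i<n} (c − ζⁱ)`), and ★ `exists_isIntegral_mul_inv_intCast_sub`: for `μ ∈ ℂ`, `μⁿ = 1`,
  `μ ≠ 1`, `p ∤ n`, `c ∈ ℤ`, `p ∣ c − 1`: `c − μ ≠ 0` and `s·(c − μ)⁻¹ ∈ ℤ̄` for some `s ∈ ℕ`, `p ∤ s`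
  (`s = |Σ_{i<n} cⁱ| ≡ n (mod p)`, `s·(c − μ)⁻¹ = ±∏_{μ′ⁿ = 1, μ′ ∉ {1, μ}} (c − μ′)`). This is WHY F″ carries the
  binder `p ∤ ord χ`: for `ord χ = p` every `χ(c) ≠ 1` has `1 − χ(c) ∣ p`.
* §3 Kato's factor: `exists_isIntegral_mul_inv_katoFactor` (`c² − cμ ≠ 0` with `p`-integral inverse),
  `exists_isIntegral_mul_inv_katoT` (`T = (c² − cμ)(d² − dν)`).

References: [Kato2004Asterisque] K. Kato, Astérisque 295 (2004), Thm. 6.6 (1) p. 163 (the factor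
`(c² − c^u χ(c))(d² − d^v χ̄(d))`, case `ξ ∈ SL₂(ℤ)`, `c ≡ d ≡ 1 mod N`), (4.2.4) p. 143, (8.1.2)–(8.1.3) p. 180,
Ex. 13.3 p. 225, Thm. 13.6 p. 227; F″'s docstring item 4/(a) in
`Literature/NumberTheory/EllipticCurves/KatoAdditiveTwistedValueNeronIntegrality.lean`; programme
`Cruxes/StarredOptimalManinUnitFiveSeven/Lines/kato-lever-F2-programme.md` §1 (value law in the Néron basis:
`Σ_b χ(b)σ_b(y) = T·u·n_ξ·L_S(f,χ,1)/Ω^±`), §4. The cyclotomic identity is [folklore] (Mathlib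
`IsPrimitiveRoot.prod_one_sub_pow_eq_order` is its value at `c = 1`).
-/

set_option autoImplicit false
-- the Theorems namespace of a single-conjunct summit repeats the summit name by design (D-0017)
set_option linter.dupNamespace false

noncomputable section

open scoped BigOperators
open Finset Polynomial

namespace Summit.BirchSwinnertonDyer.BirchSwinnertonDyer.Theorems.KatoUnitChoice


/-! ## §1 The currency "`x` is `p`-integral": `∃ s : ℕ, ¬ p ∣ s ∧ IsIntegral ℤ ((s : ℂ) * x)` -/

variable {p : ℕ} [Fact p.Prime]

omit [Fact p.Prime] in
/-- An INTEGER multiplier prime to `p` may be replaced by a NATURAL one: if `a·x ∈ ℤ̄` with `a ∈ ℤ`,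
`p ∤ a`, then `s·x ∈ ℤ̄` for `s = |a| ∈ ℕ`, `p ∤ s`. [folklore] -/
theorem exists_nat_of_isIntegral_int_mul {a : ℤ} (ha : ¬ (p : ℤ) ∣ a) {x : ℂ}
    (hx : IsIntegral ℤ ((a : ℂ) * x)) : ∃ s : ℕ, ¬ p ∣ s ∧ IsIntegral ℤ ((s : ℂ) * x) := by
  refine ⟨a.natAbs, fun h ↦ ha (Int.ofNat_dvd_left.2 h), ?_⟩
  rcases Int.natAbs_eq a with h | h
  · have hcast : ((a.natAbs : ℕ) : ℂ) = (a : ℂ) := by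
      have h' := congrArg (Int.cast : ℤ → ℂ) h
      rw [Int.cast_natCast] at h'
      exact h'.symm
    rw [hcast]
    exact hx
  · have hcast : ((a.natAbs : ℕ) : ℂ) = -(a : ℂ) := by
      have h' := congrArg (Int.cast : ℤ → ℂ) h
      rw [Int.cast_neg, Int.cast_natCast] at h'
      rw [h', neg_neg]
    rw [hcast, neg_mul]
    exact hx.neg

/-- PRODUCTS: if `x` and `y` are `p`-integral then so is `x·y` (`s = s₁s₂`). [folklore] -/
theorem exists_isIntegral_mul {x y : ℂ} (hx : ∃ s : ℕ, ¬ p ∣ s ∧ IsIntegral ℤ ((s : ℂ) * x))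
    (hy : ∃ s : ℕ, ¬ p ∣ s ∧ IsIntegral ℤ ((s : ℂ) * y)) :
    ∃ s : ℕ, ¬ p ∣ s ∧ IsIntegral ℤ ((s : ℂ) * (x * y)) := by
  obtain ⟨s, hs, hsx⟩ := hx
  obtain ⟨t, ht, hty⟩ := hy
  refine ⟨s * t, fun h ↦ ((Fact.out : p.Prime).dvd_mul.1 h).elim hs ht, ?_⟩
  have hcast : ((s * t : ℕ) : ℂ) * (x * y) = ((s : ℂ) * x) * ((t : ℂ) * y) := by
    push_cast
    ring
  rw [hcast]
  exact hsx.mul hty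

/-- DIVISION: if `T·x` is `p`-integral, `T⁻¹` is `p`-integral and `T ≠ 0`, then `x` is `p`-integral
(`s·t·x = (s·T·x)·(t·T⁻¹)`). This is the step "divide by the unit `T`" of F″'s derivation, item 4.
[folklore] -/
theorem exists_isIntegral_of_mul_left {T x : ℂ} (hT : T ≠ 0)
    (h : ∃ s : ℕ, ¬ p ∣ s ∧ IsIntegral ℤ ((s : ℂ) * (T * x)))
    (hinv : ∃ s : ℕ, ¬ p ∣ s ∧ IsIntegral ℤ ((s : ℂ) * T⁻¹)) :
    ∃ s : ℕ, ¬ p ∣ s ∧ IsIntegral ℤ ((s : ℂ) * x) := by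
  obtain ⟨u, hu, hux⟩ := exists_isIntegral_mul h hinv
  refine ⟨u, hu, ?_⟩
  have hcalc : (u : ℂ) * (T * x * T⁻¹) = (u : ℂ) * x := by
    rw [mul_assoc T x, mul_comm x, ← mul_assoc T, mul_inv_cancel₀ hT, one_mul]
  rw [← hcalc]
  exact hux

omit [Fact p.Prime] in
/-- A natural number `q` prime to `p` is a `p`-unit: `q⁻¹` is `p`-integral (`s = q`). [folklore] -/
theorem exists_isIntegral_mul_inv_natCast {q : ℕ} (hq : ¬ p ∣ q) :
    ∃ s : ℕ, ¬ p ∣ s ∧ IsIntegral ℤ ((s : ℂ) * (q : ℂ)⁻¹) := by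
  have hq0' : q ≠ 0 := fun h ↦ hq (h ▸ dvd_zero p)
  have hq0 : (q : ℂ) ≠ 0 := by exact_mod_cast hq0'
  refine ⟨q, hq, ?_⟩
  rw [mul_inv_cancel₀ hq0]
  exact isIntegral_one

omit [Fact p.Prime] in
/-- A rational number `w` whose numerator is prime to `p` has `p`-integral inverse (`s = |num w|`,
`s·w⁻¹ = ±den w`); e.g. Kato's real-structure factor `u ∈ {1, 2, ½}` and the Manin-symbol coordinate
`n_ξ ∈ {±½, ±1}` at odd `p`. [folklore] -/
theorem exists_isIntegral_mul_inv_ratCast {w : ℚ} (hw : ¬ (p : ℤ) ∣ w.num) :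
    ∃ s : ℕ, ¬ p ∣ s ∧ IsIntegral ℤ ((s : ℂ) * (w : ℂ)⁻¹) := by
  have hw0 : w ≠ 0 := by
    rintro rfl
    exact hw (by simp)
  refine exists_nat_of_isIntegral_int_mul hw ?_
  have hnum : (w.num : ℂ) ≠ 0 := by exact_mod_cast Rat.num_ne_zero.2 hw0
  have hcalc : ((w.num : ℤ) : ℂ) * (w : ℂ)⁻¹ = ((w.den : ℤ) : ℂ) := by
    rw [Rat.cast_def, inv_div, mul_div_assoc', mul_div_cancel_left₀ _ hnum]
    norm_cast
  rw [hcalc]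
  simpa using isIntegral_algebraMap (R := ℤ) (A := ℂ) (x := (w.den : ℤ))

/-! ## §2 The cyclotomic unit at `p`: `c − μ` for `μⁿ = 1`, `μ ≠ 1`, `p ∤ n`, `c ≡ 1 (mod p)` -/

/-- In an integral domain with a primitive `n`-th root of unity `ζ` (`0 < n`), for every `c`:
`Σ_{i<n} cⁱ = ∏_{0<i<n} (c − ζⁱ)` — the quotient `(Xⁿ − 1)/(X − 1) = ∏_{0<i<n}(X − ζⁱ)` evaluated at `c`
(Mathlib's `IsPrimitiveRoot.prod_one_sub_pow_eq_order` is the case `c = 1`). [folklore] -/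
theorem geom_sum_eq_prod_sub_pow {R : Type*} [CommRing R] [IsDomain R] {n : ℕ} {ζ : R}
    (hζ : IsPrimitiveRoot ζ n) (hn : 0 < n) (c : R) :
    ∑ i ∈ range n, c ^ i = ∏ i ∈ (range n).erase 0, (c - ζ ^ i) := by
  have h := X_pow_sub_C_eq_prod hζ hn (one_pow n)
  simp only [mul_one] at h
  -- `h : X ^ n - C 1 = ∏ i ∈ range n, (X - C (ζ ^ i))`
  have hsplit : ∏ i ∈ range n, (X - C (ζ ^ i)) =
      (X - C (ζ ^ 0)) * ∏ i ∈ (range n).erase 0, (X - C (ζ ^ i)) :=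
    (Finset.mul_prod_erase (range n) (fun i ↦ X - C (ζ ^ i)) (mem_range.2 hn)).symm
  have key : (X - C 1 : R[X]) * ∑ i ∈ range n, X ^ i =
      (X - C 1) * ∏ i ∈ (range n).erase 0, (X - C (ζ ^ i)) := by
    rw [C_1, mul_geom_sum, ← C_1, h, hsplit, pow_zero]
  replace key := mul_left_cancel₀ (X_sub_C_ne_zero (1 : R)) key
  apply_fun Polynomial.eval c at key
  simpa only [eval_prod, eval_sub, eval_X, eval_pow, eval_C, eval_geom_sum] using key

/-- ★ **The cyclotomic unit at `p`.** For `μ ∈ ℂ` with `μⁿ = 1`, `μ ≠ 1`, `p ∤ n`, and `c ∈ ℤ` with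
`p ∣ c − 1`: `c − μ ≠ 0` and `s·(c − μ)⁻¹` is an algebraic integer for some `s ∈ ℕ` with `p ∤ s` — namely
`s = |Σ_{i<n} cⁱ|` (`≡ n ≢ 0 (mod p)`), `s·(c − μ)⁻¹ = ±∏_{μ′ⁿ = 1, μ′ ∉ {1, μ}} (c − μ′)`. (F″ docstring item
4 / (a): "`1 − ζ_n` divides `n'` for a prime `n' ≠ p` or is a unit, so `T` is a `p`-unit".) [folklore] -/
theorem exists_isIntegral_mul_inv_intCast_sub {n : ℕ} (hn : ¬ p ∣ n) {μ : ℂ} (hμ : μ ^ n = 1)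
    (hμ1 : μ ≠ 1) {c : ℤ} (hc : (p : ℤ) ∣ c - 1) :
    (c : ℂ) - μ ≠ 0 ∧ ∃ s : ℕ, ¬ p ∣ s ∧ IsIntegral ℤ ((s : ℂ) * ((c : ℂ) - μ)⁻¹) := by
  have hn0 : n ≠ 0 := by
    rintro rfl
    exact hn (dvd_zero p)
  have hnpos : 0 < n := Nat.pos_of_ne_zero hn0
  haveI : NeZero n := ⟨hn0⟩
  have hζ : IsPrimitiveRoot (Complex.exp (2 * Real.pi * Complex.I / n)) n :=
    Complex.isPrimitiveRoot_exp n hn0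
  set ζ : ℂ := Complex.exp (2 * Real.pi * Complex.I / n) with hζdef
  obtain ⟨j, hjn, hjμ⟩ := hζ.eq_pow_of_pow_eq_one hμ
  have hj0 : j ≠ 0 := by
    rintro rfl
    exact hμ1 (by rw [← hjμ, pow_zero])
  have hjmem : j ∈ (range n).erase 0 := Finset.mem_erase.2 ⟨hj0, mem_range.2 hjn⟩
  -- the integer multiplier `S = Σ_{i<n} cⁱ ≡ n (mod p)`
  set S : ℤ := ∑ i ∈ range n, c ^ i with hSdef
  have hc1 : (c : ZMod p) = 1 := by
    have h0 : ((c - 1 : ℤ) : ZMod p) = 0 := (ZMod.intCast_zmod_eq_zero_iff_dvd (c - 1) p).2 hc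
    push_cast at h0
    exact sub_eq_zero.1 h0
  have hSp : ¬ (p : ℤ) ∣ S := by
    intro hdvd
    have hS : (S : ZMod p) = (n : ZMod p) := by
      rw [hSdef]
      push_cast
      simp [hc1]
    have hn' : (n : ZMod p) = 0 := by
      rw [← hS]
      exact (ZMod.intCast_zmod_eq_zero_iff_dvd S p).2 hdvd
    exact hn ((ZMod.natCast_eq_zero_iff n p).1 hn')
  -- the identity `S = (c − μ) · ∏_{i ∉ {0, j}} (c − ζⁱ)`
  have hident : (S : ℂ) = ∏ i ∈ (range n).erase 0, ((c : ℂ) - ζ ^ i) := by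
    rw [hSdef]
    push_cast
    exact geom_sum_eq_prod_sub_pow hζ hnpos (c : ℂ)
  have hsplit : ∏ i ∈ (range n).erase 0, ((c : ℂ) - ζ ^ i) =
      ((c : ℂ) - μ) * ∏ i ∈ ((range n).erase 0).erase j, ((c : ℂ) - ζ ^ i) := by
    rw [← hjμ]
    exact (Finset.mul_prod_erase _ (fun i ↦ (c : ℂ) - ζ ^ i) hjmem).symm
  have hS0' : S ≠ 0 := fun h ↦ hSp (h ▸ dvd_zero _)
  have hS0 : (S : ℂ) ≠ 0 := by exact_mod_cast hS0'
  have hcμ : (c : ℂ) - μ ≠ 0 := by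
    intro h
    apply hS0
    rw [hident, hsplit, h, zero_mul]
  refine ⟨hcμ, exists_nat_of_isIntegral_int_mul hSp ?_⟩
  rw [hident, hsplit, mul_comm ((c : ℂ) - μ), mul_assoc, mul_inv_cancel₀ hcμ, mul_one]
  have hcint : IsIntegral ℤ (c : ℂ) := by simpa using isIntegral_algebraMap (R := ℤ) (A := ℂ) (x := c)
  exact IsIntegral.prod _ fun i _ ↦ hcint.sub ((hζ.isIntegral hnpos).pow i)

/-! ## §3 Kato's factor `c² − c·μ` and `T = (c² − c·μ)(d² − d·ν)` -/

/-- `p ∣ c − 1 ⟹ p ∤ c` (plumbing). [folklore] -/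
theorem not_dvd_of_dvd_sub_one {c : ℤ} (hc : (p : ℤ) ∣ c - 1) : ¬ (p : ℤ) ∣ c := by
  intro h
  have h1 : (p : ℤ) ∣ 1 := by simpa using dvd_sub h hc
  exact (Fact.out : p.Prime).ne_one (by exact_mod_cast Int.eq_one_of_dvd_one (by positivity) h1)

/-- **Kato's factor.** For `μ ∈ ℂ` with `μⁿ = 1`, `μ ≠ 1`, `p ∤ n`, `c ∈ ℤ`, `p ∣ c − 1`: the factor
`c² − c·μ = c·(c − μ)` of Thm. 6.6 (1) (`(c² − c^u χ(c))` with `u = 1`) is non-zero and its inverse is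
`p`-integral. [cite: Kato2004Asterisque, Thm. 6.6 (1) p. 163 and (4.2.4) p. 143] -/
theorem exists_isIntegral_mul_inv_katoFactor {n : ℕ} (hn : ¬ p ∣ n) {μ : ℂ} (hμ : μ ^ n = 1)
    (hμ1 : μ ≠ 1) {c : ℤ} (hc : (p : ℤ) ∣ c - 1) :
    (c : ℂ) ^ 2 - (c : ℂ) * μ ≠ 0 ∧
      ∃ s : ℕ, ¬ p ∣ s ∧ IsIntegral ℤ ((s : ℂ) * ((c : ℂ) ^ 2 - (c : ℂ) * μ)⁻¹) := by
  have hpc : ¬ (p : ℤ) ∣ c := not_dvd_of_dvd_sub_one hc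
  have hc0' : c ≠ 0 := fun h ↦ hpc (h ▸ dvd_zero _)
  have hc0 : (c : ℂ) ≠ 0 := by exact_mod_cast hc0'
  obtain ⟨hcμ, h1⟩ := exists_isIntegral_mul_inv_intCast_sub hn hμ hμ1 hc
  have h2 : ∃ s : ℕ, ¬ p ∣ s ∧ IsIntegral ℤ ((s : ℂ) * (c : ℂ)⁻¹) :=
    exists_nat_of_isIntegral_int_mul hpc (by rw [mul_inv_cancel₀ hc0]; exact isIntegral_one)
  have hfac : (c : ℂ) ^ 2 - (c : ℂ) * μ = (c : ℂ) * ((c : ℂ) - μ) := by ring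
  refine ⟨by rw [hfac]; exact mul_ne_zero hc0 hcμ, ?_⟩
  rw [hfac, mul_inv]
  exact exists_isIntegral_mul h2 h1

/-- **Kato's `T`.** For roots of unity `μ, ν ∈ ℂ` of orders prime to `p`, both `≠ 1`, and integers
`c, d ≡ 1 (mod p)`: `T = (c² − cμ)(d² − dν)` is non-zero with `p`-integral inverse — the shape of
`(c² − c^u χ(c))(d² − d^v χ̄(d))`, `(u, v) = (1, 1)`. [cite: Kato2004Asterisque, Thm. 6.6 (1) p. 163] -/
theorem exists_isIntegral_mul_inv_katoT {n n' : ℕ} (hn : ¬ p ∣ n) (hn' : ¬ p ∣ n') {μ ν : ℂ}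
    (hμ : μ ^ n = 1) (hμ1 : μ ≠ 1) (hν : ν ^ n' = 1) (hν1 : ν ≠ 1) {c d : ℤ} (hc : (p : ℤ) ∣ c - 1)
    (hd : (p : ℤ) ∣ d - 1) :
    ((c : ℂ) ^ 2 - (c : ℂ) * μ) * ((d : ℂ) ^ 2 - (d : ℂ) * ν) ≠ 0 ∧
      ∃ s : ℕ, ¬ p ∣ s ∧
        IsIntegral ℤ ((s : ℂ) * (((c : ℂ) ^ 2 - (c : ℂ) * μ) * ((d : ℂ) ^ 2 - (d : ℂ) * ν))⁻¹) := by
  obtain ⟨hc0, hcint⟩ := exists_isIntegral_mul_inv_katoFactor hn hμ hμ1 hc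
  obtain ⟨hd0, hdint⟩ := exists_isIntegral_mul_inv_katoFactor hn' hν hν1 hd
  refine ⟨mul_ne_zero hc0 hd0, ?_⟩
  rw [mul_inv]
  exact exists_isIntegral_mul hcint hdint

end Summit.BirchSwinnertonDyer.BirchSwinnertonDyer.Theorems.KatoUnitChoice

end
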